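import Summits.RiemannHypothesis.RiemannHypothesis.Theorems.SuzukiStructureFunctionsZetaInversion
import Summits.RiemannHypothesis.RiemannHypothesis.Theorems.SuzukiStructureFunctionsHalfPlane

/-!
# SuzukiStructureFunctionsZetaFormulas — Suzuki's Thm. 2.2 objects for `ζ`, itemised: `A_ζ^{ω,ν}(t,·)`,
# `B_ζ^{ω,ν}(t,·)` real entire (even/odd) for all `t ≥ 0`, and `E_ζ^{ω,ν}(t,z)` from the kernel (column DBR; RH-FREE)

LINE 1 — LABEL: RH-FREE (corollaries of the general structure-function files at the Suzuki pair
`(ϱ_ζ^{ω,ν}, K_ζ^{ω,ν})`, `isSuzukiPair_zeta`, on the unconditional windows `exists_isSuzukiPhiSolution_suzukiKernel`);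
bears_on LADDER-RH B-D → B-P(P1)/(P3). WHAT THIS IS NOT: not progress toward RH; `E_ζ^{ω,ν}(t,·) ∈ HB̄` (Thm. 2.4) is
NOT claimed; nothing here bears on the truth of RH.

Source: M. Suzuki, J. Funct. Anal. 281 (2021) 109116 = arXiv:1606.05726 [Suzuki2021Hamiltonians], Thm. 2.2 / (2.12),
Thm. 3.1 (1), (3), eq. (3.27).

Contents (seat rh-dbr-eng-5 g7): `abs_suzukiKernel_le_exp_abs`; `differentiable_suzukiAt`, `differentiable_suzukiBt`
(entire); `suzukiAt_neg`, `suzukiBt_neg` (even/odd); `sharp_suzukiAt`, `sharp_suzukiBt` (real entire),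
`suzukiAt_suzukiBt_ofReal_im`; **`suzukiEt_eq_halfPlane`** —
`E_ζ^{ω,ν}(t,z) = ½ξ(½+ω−iz)^ν (m(t)(e^{izt} + ∫_t^∞φ⁺(t,x)e^{izx}dx) + m(t)⁻¹(e^{izt} − ∫_t^∞φ⁻(t,x)e^{izx}dx))` on
`Im z > 1+ω` for all `t ≥ 0` (`ω ≥ ½`, `ν ≥ 1`, `νω > 1`); `hamiltonian_suzukiKernel_det_posDef`.
-/

noncomputable section

-- D-0017: `Summit.<S>.<S>.…` is the designed namespace of a single-problem summit.
set_option linter.dupNamespace false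

open MeasureTheory Set Complex Filter Topology
open scoped ComplexConjugate

namespace Summit.RiemannHypothesis.RiemannHypothesis.Theorems.SuzukiStructureFunctions

open Literature.NumberTheory.LFunctions Literature.NumberTheory.LFunctions.SuzukiStructure
open Literature.Analysis.DeBrangesSpaces (sharp)
open Summit.RiemannHypothesis.RiemannHypothesis.Theorems.SuzukiPhiExistence (exists_isSuzukiPhiSolution_suzukiKernel)

variable {ω : ℝ} {ν : ℕ} {t : ℝ}

/-! ## §14 Suzuki's Thm. 2.2 objects for `ζ`, itemised: `A_ζ^{ω,ν}(t,·)`, `B_ζ^{ω,ν}(t,·)` real entire, even/odd,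
and `E_ζ^{ω,ν}(t,z)` from the kernel on `Im z > 1 + ω` -/

/-- RH-FREE. Exponential growth of `K_ζ^{ω,ν}` in the two-sided form used by the structure-function files:
`|K_ζ^{ω,ν}(x)| ≤ D e^{(1+ω)|x|}` (`ω > 0`, `νω > 1`). -/
theorem abs_suzukiKernel_le_exp_abs (hω : 0 < ω) (ν : ℕ) (hνω : 1 < (ν : ℝ) * ω) :
    ∃ D : ℝ, 0 ≤ D ∧ ∀ x : ℝ, |suzukiKernel ω ν x| ≤ D * Real.exp ((1 + ω) * |x|) := by
  obtain ⟨D, hD0, hKle⟩ := suzuki2021_prop41_v hω ν hνω (v := 1 + ω) (by linarith)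
  refine ⟨D, hD0, fun x => (hKle x).trans ?_⟩
  exact mul_le_mul_of_nonneg_left (Real.exp_le_exp.2
    (mul_le_mul_of_nonneg_left (le_abs_self x) (by linarith))) hD0

/-- RH-FREE. **`A_ζ^{ω,ν}(t,·)` is entire** for every `t ≥ 0` (`ω ≥ ½`, `ν ≥ 1`, `νω > 1`). -/
theorem differentiable_suzukiAt (hω : 1 / 2 ≤ ω) (hν : 1 ≤ ν) (hνω : 1 < (ν : ℝ) * ω) (ht : 0 ≤ t) :
    Differentiable ℂ (suzukiAt ω ν t) :=
  differentiable_structA (isSuzukiPair_zeta (by linarith) hν hνω)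
    (exists_isSuzukiPhiSolution_suzukiKernel hω hν hνω ht (Or.inl rfl))

/-- RH-FREE. **`B_ζ^{ω,ν}(t,·)` is entire** for every `t ≥ 0` (`ω ≥ ½`, `ν ≥ 1`, `νω > 1`). -/
theorem differentiable_suzukiBt (hω : 1 / 2 ≤ ω) (hν : 1 ≤ ν) (hνω : 1 < (ν : ℝ) * ω) (ht : 0 ≤ t) :
    Differentiable ℂ (suzukiBt ω ν t) :=
  differentiable_structB (isSuzukiPair_zeta (by linarith) hν hνω)
    (exists_isSuzukiPhiSolution_suzukiKernel hω hν hνω ht (Or.inr rfl))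

/-- RH-FREE. `A_ζ^{ω,ν}(t,·)` is even (Thm. 2.2 via Thm. 3.1 (3)). -/
theorem suzukiAt_neg (hω : 1 / 2 ≤ ω) (hν : 1 ≤ ν) (hνω : 1 < (ν : ℝ) * ω) (ht : 0 ≤ t) (z : ℂ) :
    suzukiAt ω ν t (-z) = suzukiAt ω ν t z :=
  structA_neg (isSuzukiPair_zeta (by linarith) hν hνω)
    (exists_isSuzukiPhiSolution_suzukiKernel hω hν hνω ht (Or.inl rfl)) z

/-- RH-FREE. `B_ζ^{ω,ν}(t,·)` is odd (Thm. 2.2 via Thm. 3.1 (3)). -/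
theorem suzukiBt_neg (hω : 1 / 2 ≤ ω) (hν : 1 ≤ ν) (hνω : 1 < (ν : ℝ) * ω) (ht : 0 ≤ t) (z : ℂ) :
    suzukiBt ω ν t (-z) = -suzukiBt ω ν t z :=
  structB_neg (isSuzukiPair_zeta (by linarith) hν hνω)
    (exists_isSuzukiPhiSolution_suzukiKernel hω hν hνω ht (Or.inr rfl)) z

/-- RH-FREE. `A_ζ^{ω,ν}(t,·)` is a REAL entire function: `A♯ = A`. -/
theorem sharp_suzukiAt (hω : 1 / 2 ≤ ω) (hν : 1 ≤ ν) (hνω : 1 < (ν : ℝ) * ω) (ht : 0 ≤ t) (z : ℂ) :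
    sharp (suzukiAt ω ν t) z = suzukiAt ω ν t z :=
  sharp_structA (isSuzukiPair_zeta (by linarith) hν hνω)
    (exists_isSuzukiPhiSolution_suzukiKernel hω hν hνω ht (Or.inl rfl)) z

/-- RH-FREE. `B_ζ^{ω,ν}(t,·)` is a REAL entire function: `B♯ = B`. -/
theorem sharp_suzukiBt (hω : 1 / 2 ≤ ω) (hν : 1 ≤ ν) (hνω : 1 < (ν : ℝ) * ω) (ht : 0 ≤ t) (z : ℂ) :
    sharp (suzukiBt ω ν t) z = suzukiBt ω ν t z :=
  sharp_structB (isSuzukiPair_zeta (by linarith) hν hνω)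
    (exists_isSuzukiPhiSolution_suzukiKernel hω hν hνω ht (Or.inr rfl)) z

/-- RH-FREE. `A_ζ^{ω,ν}(t,x)`, `B_ζ^{ω,ν}(t,x)` are real for real `x`. -/
theorem suzukiAt_suzukiBt_ofReal_im (hω : 1 / 2 ≤ ω) (hν : 1 ≤ ν) (hνω : 1 < (ν : ℝ) * ω) (ht : 0 ≤ t) (x : ℝ) :
    (suzukiAt ω ν t x).im = 0 ∧ (suzukiBt ω ν t x).im = 0 :=
  ⟨structA_ofReal_im (isSuzukiPair_zeta (by linarith) hν hνω)
      (exists_isSuzukiPhiSolution_suzukiKernel hω hν hνω ht (Or.inl rfl)) x,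
    structB_ofReal_im (isSuzukiPair_zeta (by linarith) hν hνω)
      (exists_isSuzukiPhiSolution_suzukiKernel hω hν hνω ht (Or.inr rfl)) x⟩

/-- **RH-FREE · `E_ζ^{ω,ν}(t,z)` FROM THE KERNEL, EXPLICITLY** (Thm. 2.2's structure function via (3.27)₂, (3.38),
(3.39) and Lemma 4.1): for `ω ≥ ½`, `ν ≥ 1`, `νω > 1`, every `t ≥ 0` and every `z` with `Im z > 1 + ω`,
`E_ζ^{ω,ν}(t,z) = ½ ξ(½+ω−iz)^ν · ( m(t)(e^{izt} + ∫_t^∞ φ⁺(t,x)e^{izx} dx) + m(t)⁻¹(e^{izt} − ∫_t^∞ φ⁻(t,x)e^{izx} dx) )`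
with `φ^{±}(t,·) = suzukiPhiPlus/Minus ω ν t` and `m = SuzukiStructure.m (suzukiKernel ω ν)`. -/
theorem suzukiEt_eq_halfPlane (hω : 1 / 2 ≤ ω) (hν : 1 ≤ ν) (hνω : 1 < (ν : ℝ) * ω) (ht : 0 ≤ t)
    {z : ℂ} (hz : 1 + ω < z.im) :
    suzukiEt ω ν t z = 1 / 2 * suzukiE ω ν z *
      ((m (suzukiKernel ω ν) t : ℂ) *
          (cexp (I * z * t) + ∫ x in Ioi t, (suzukiPhiPlus ω ν t x : ℂ) * cexp (I * z * x)) +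
        ((m (suzukiKernel ω ν) t)⁻¹ : ℝ) *
          (cexp (I * z * t) - ∫ x in Ioi t, (suzukiPhiMinus ω ν t x : ℂ) * cexp (I * z * x))) := by
  obtain ⟨D, _, hKle⟩ := abs_suzukiKernel_le_exp_abs (by linarith : 0 < ω) ν hνω
  have h := structE_eq_halfPlane (isSuzukiPair_zeta (by linarith) hν hνω)
    (exists_isSuzukiPhiSolution_suzukiKernel hω hν hνω ht (Or.inl rfl))
    (exists_isSuzukiPhiSolution_suzukiKernel hω hν hνω ht (Or.inr rfl)) (by linarith : (0:ℝ) ≤ 1 + ω) hKle hz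
  rw [suzukiEt, h, fourier_suzukiRho ω hν z, suzukiPhiPlus_def, suzukiPhiMinus_def]

/-- RH-FREE. Suzuki's Hamiltonian (3.33) for the `ζ` kernel, `H(t) = diag(1/m(t)², m(t)²)`, is positive definite
of determinant one at every `t` (by construction). -/
theorem hamiltonian_suzukiKernel_det_posDef (ω : ℝ) (ν : ℕ) (t : ℝ) :
    (hamiltonian (suzukiKernel ω ν) t).det = 1 ∧ (hamiltonian (suzukiKernel ω ν) t).PosDef :=
  ⟨hamiltonian_det _ t, hamiltonian_posDef _ t⟩

end Summit.RiemannHypothesis.RiemannHypothesis.Theorems.SuzukiStructureFunctions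

end
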